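import Summits.Schanuel.Schanuel.Theorems.ZilberEacBranchTrichotomy
import Summits.Schanuel.Schanuel.Theorems.ZilberEacTranscendenceDensityPole
import HarnessLib

/-!
# The equimodular class, LX: the growth / resonance / Kronecker trichotomy along a RAMIFIED cycle —
# density from a transcendental ramified witness

HONEST FRAMING.  Cell `pub-schanuel` (Zilber's Exponential-Algebraic Closedness, case ladder;
host summit Schanuel), seat 2, gen 26.  File XXVI (`unprojectedDense_of_branch_witness`) turns an
exact identity `exp(p(z_m)) = exp(P̃(τ + 2πi(k₀ + m))) · w(1/z_m)` with a TRANSCENDENTAL `w` into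
Zariski density of the exponential points of `W = {x₁ = p(x₀), Q(x₀, y₀) = 0}`.  On a ramified cycle
at infinity (files LIII, LVII, LVIII) the exponential points with `k`-th-power labels satisfy instead
`exp(p(z_j)) = exp(Π(m₀ + j)) · w(μ_j)` with `z_j = U(μ_j) μ_j^{-k}`, `μ_j → 0`, and `w` transcendental
ALONG THE RAMIFIED PARAMETRISATION (no `H ≠ 0` with `H(U(μ)μ^{-k}, w(μ)) = 0` near `μ = 0`).
**`unprojectedDense_of_ramified_witness`**: then `W` has Zariski-dense exponential points — the
proof of file XXVI verbatim with THEOREM T in the form of file LIX and the logarithmic bound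
`log(3 + 3(m₀ + j)^k) ≤ k·log(3 + 3(m₀ + j))` in THEOREM G.  Complete classes of instances of an
OPEN question (Mantova–Masser, PLMS 2024 §1 p. 5); EC(3,2) OPEN; NOT Schanuel's conjecture
(neither used nor implied; EAC ⇏ SC).
-/

noncomputable section

open Filter Topology Set Complex MvPolynomial
open Literature.NumberTheory.Transcendental Literature.ModelTheory.Zilber
open Literature.ModelTheory.ExponentialFields

set_option linter.dupNamespace false

namespace Summit.Schanuel.Schanuel.Theorems

/-- `log(3 + 3x^k) ≤ k·log(3 + 3x)` for `x ≥ 0`, `k ≥ 1` (since `3 + 3x^k ≤ (3 + 3x)^k`).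
[folklore] -/
theorem log_three_add_pow_le {x : ℝ} (hx : 0 ≤ x) {k : ℕ} (hk : 1 ≤ k) :
    Real.log (3 + 3 * x ^ k) ≤ k * Real.log (3 + 3 * x) := by
  have hk0 : k ≠ 0 := by omega
  have h1 : 1 + x ^ k ≤ (1 + x) ^ k := by
    have := pow_add_pow_le (zero_le_one : (0 : ℝ) ≤ 1) hx hk0
    rwa [one_pow] at this
  have h3 : (3 : ℝ) ≤ 3 ^ k := by
    calc (3 : ℝ) = 3 ^ 1 := (pow_one _).symm
      _ ≤ 3 ^ k := pow_le_pow_right₀ (by norm_num) hk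
  have hle : 3 + 3 * x ^ k ≤ (3 + 3 * x) ^ k := by
    rw [show (3 + 3 * x : ℝ) = 3 * (1 + x) by ring, mul_pow]
    have h0 : (0 : ℝ) ≤ 1 + x ^ k := by positivity
    nlinarith
  rw [← Real.log_pow]
  exact Real.log_le_log (by positivity) hle

/-- **Density from a transcendental ramified witness** (growth / resonance / Kronecker trichotomy
along a ramified cycle at infinity).  See the module docstring.
[cite: MantovaMasser2023, §1 Further remarks, p. 5 (the question, open in general)]
(new in this form) -/
theorem unprojectedDense_of_ramified_witness (Q : Polynomial (Polynomial ℂ))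
    {P : MvPolynomial (Fin 2) ℂ}
    (hP : ∀ x y : ℂ, MvPolynomial.eval ![x, y] P = (Q.map (Polynomial.evalRingHom x)).eval y)
    (hirr : Irreducible P) (p : Polynomial ℂ) (Pl : Polynomial ℂ)
    {U w : ℂ → ℂ} (hU : AnalyticAt ℂ U 0) (hw : AnalyticAt ℂ w 0) (hw0 : ∀ u, w u ≠ 0)
    {k : ℕ} (hk : 1 ≤ k)
    (htr : ∀ H : Polynomial (Polynomial ℂ), H ≠ 0 →
      ¬ (∀ᶠ u in 𝓝[≠] (0 : ℂ),
        (H.map (Polynomial.evalRingHom (U u * u⁻¹ ^ k))).eval (w u) = 0))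
    (m₀ : ℕ) {μ z : ℕ → ℂ} (hμ0 : ∀ j, μ j ≠ 0) (hμ : Tendsto μ atTop (𝓝 0))
    (hzμ : ∀ j, z j = U (μ j) * (μ j)⁻¹ ^ k)
    (hzeq : ∀ j, (Q.map (Polynomial.evalRingHom (z j))).eval (Complex.exp (z j)) = 0)
    (hznorm : Tendsto (fun j => ‖z j‖) atTop atTop) {α : ℝ} (hα : 0 ≤ α)
    (hzup : ∀ j, ‖z j‖ ≤ α + 7 * (((m₀ + j) ^ k : ℕ) : ℝ))
    (hid₀ : ∀ j, Complex.exp (p.eval (z j)) =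
      Complex.exp (Pl.eval ((m₀ + j : ℕ) : ℂ)) * w (μ j)) :
    UnprojectedDense {w : Fin 2 ⊕ Fin 2 → ℂ | w (Sum.inl 1) = p.eval (w (Sum.inl 0)) ∧
      MvPolynomial.eval ![w (Sum.inl 0), w (Sum.inr 0)] P = 0} := by
  classical
  -- the phase polynomial `j ↦ Π(j)` and its real and imaginary parts
  obtain ⟨gR, gI, hgR, hexpPK⟩ := exists_re_im_polynomials Pl
  -- the exact identity with labels `m₀ + j`, through the real polynomials
  have hid : ∀ j, Complex.exp (p.eval (z j)) =
      urot (gI.eval ((m₀ + j : ℕ) : ℝ)) *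
        ((Real.exp (gR.eval ((m₀ + j : ℕ) : ℝ)) : ℂ) * w (μ j)) := by
    intro j
    rw [hid₀ j, ← Complex.ofReal_natCast, hexpPK]
    ring
  -- the sequence of exponential points of the surface
  have hirr3 := irreducible_rename_castSucc₂ hirr
  have hS := isIrreducibleClosed_graphSurface p hirr3
  have hdim := zariskiDim_graphSurface p hirr3
  rw [fibreCurveSurface_eq]
  set S := {w : Fin 2 ⊕ Fin 2 → ℂ | w (Sum.inl 1) = p.eval (w (Sum.inl 0)) ∧
      MvPolynomial.eval ![w (Sum.inl 0), w (Sum.inr 0), w (Sum.inr 1)]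
        (rename (Fin.castSucc : Fin 2 → Fin 3) P) = 0} with hSdef
  set q : ℕ → Fin 2 ⊕ Fin 2 → ℂ := fun m =>
    Sum.elim ![z m, p.eval (z m)] ![Complex.exp (z m), Complex.exp (p.eval (z m))] with hq
  have hqS : ∀ m, q m ∈ S := by
    intro m
    refine ⟨by simp [hq], ?_⟩
    have ev : (![q m (Sum.inl 0), q m (Sum.inr 0), q m (Sum.inr 1)] : Fin 3 → ℂ) =
        ![z m, Complex.exp (z m), Complex.exp (p.eval (z m))] := by
      simp [hq]
    rw [ev, eval_vec3_rename_castSucc, hP]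
    exact hzeq m
  have hqΓ : ∀ m, q m ∈ expGraph ℂ 2 := by
    intro m
    rw [mem_expGraph_iff]
    intro i
    rw [Literature.ModelTheory.ExponentialFields.ExponentialRing.complex_exp_eq]
    fin_cases i <;> simp [hq]
  have hwlim : Tendsto (fun m => w (μ m)) atTop (𝓝 (w 0)) := hw.continuousAt.tendsto.comp hμ
  by_cases hgRdeg : 1 ≤ gR.natDegree
  · /- (a) GROWTH: some order of `Re p(z_j)` survives; THEOREM G -/
    have hre : ∀ m, (p.eval (z m)).re = gR.eval ((m₀ + m : ℕ) : ℝ) + Real.log ‖w (μ m)‖ := by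
      intro m
      have h1 := congrArg (fun x : ℂ => Real.log ‖x‖) (hid m)
      simp only [Complex.norm_exp, Real.log_exp, norm_mul, norm_urot, one_mul, Complex.norm_real,
        Real.norm_eq_abs, Real.abs_exp] at h1
      rw [h1, Real.log_mul (Real.exp_pos _).ne' (norm_ne_zero_iff.2 (hw0 _)), Real.log_exp]
    have hloglim : Tendsto (fun m => Real.log ‖w (μ m)‖) atTop (𝓝 (Real.log ‖w 0‖)) :=
      (Real.continuousAt_log (norm_ne_zero_iff.2 (hw0 0))).tendsto.comp hwlim.norm
    obtain ⟨M, hM⟩ : ∃ M : ℝ, ∀ m, |Real.log ‖w (μ m)‖| ≤ M := by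
      obtain ⟨C, hC⟩ := isBounded_iff_forall_norm_le.1 (Metric.isBounded_range_of_tendsto _ hloglim)
      exact ⟨C, fun m => by simpa [Real.norm_eq_abs] using hC _ ⟨m, rfl⟩⟩
    have ha : ∀ m, |(p.eval (z m)).re - gR.eval ((m₀ + m : ℕ) : ℝ)| ≤ M := by
      intro m; rw [hre m, add_sub_cancel_left]; exact hM m
    -- the denominator
    obtain ⟨D, hD, hLD⟩ := log_two_add_norm_eval_le_log_label p hα
    have hkR : (0 : ℝ) < k := by exact_mod_cast hk
    have hLD' : ∀ m, Real.log (2 + ‖p.eval (z m)‖) ≤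
        (D * k) * Real.log (3 + 3 * ((m₀ + m : ℕ) : ℝ)) := by
      intro m
      have h1 := hLD (z m) _ (Nat.cast_nonneg _) (hzup m)
      have h2 := log_three_add_pow_le (Nat.cast_nonneg (m₀ + m)) hk
      push_cast at h1 h2 ⊢
      calc Real.log (2 + ‖p.eval (z m)‖) ≤ D * Real.log (3 + 3 * ((m₀ : ℝ) + m) ^ k) := h1
        _ ≤ D * (k * Real.log (3 + 3 * ((m₀ : ℝ) + m))) := mul_le_mul_of_nonneg_left h2 hD.le
        _ = D * k * Real.log (3 + 3 * ((m₀ : ℝ) + m)) := by ring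
    have hgr : Tendsto (fun m => |(p.eval (z m)).re| / Real.log (2 + ‖p.eval (z m)‖)) atTop atTop :=
      tendsto_abs_div_log_of_linear_growth hgRdeg m₀ (by positivity) ha
        (fun m => Real.log_le_log two_pos (by linarith [norm_nonneg (p.eval (z m))])) hLD'
    refine unprojectedDense_of_growth hS (le_of_eq hdim) 1 hqS hqΓ ?_
    refine hgr.congr fun m => ?_
    simp [hq]
  · /- `g_R` is constant: the modulus of the phase factor is constant -/
    have hgR0 : gR.natDegree = 0 := by omega
    set r₀ : ℝ := gR.coeff 0 with hr₀
    have hgRev : ∀ x : ℝ, gR.eval x = r₀ := fun x => by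
      rw [Polynomial.eq_C_of_natDegree_eq_zero hgR0, Polynomial.eval_C]
    set c₀ : ℂ := ((Real.exp r₀ : ℝ) : ℂ) with hc₀
    have hc₀0 : c₀ ≠ 0 := by rw [hc₀]; exact_mod_cast (Real.exp_pos r₀).ne'
    have hid' : ∀ m, Complex.exp (p.eval (z m)) =
        urot (gI.eval ((m₀ + m : ℕ) : ℝ)) * (c₀ * w (μ m)) := by
      intro m; rw [hid m, hgRev]
    rcases urot_eval_periodic_or_not_near_finset gI with ⟨Dp, hDp, hper⟩ | hfar
    · /- (b) RESONANCE: periodic phases; constant phase on a subsequence; THEOREM T (file LIX) -/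
      set phase : ℕ → ℂ := fun k => urot (gI.eval (k : ℝ)) with hphase
      have hperiodic : Function.Periodic phase Dp := fun k => hper k
      set g : ℕ → Fin Dp := fun m => ⟨(m₀ + m) % Dp, Nat.mod_lt _ hDp⟩ with hg
      obtain ⟨i₀, hi₀⟩ := Finite.exists_infinite_fiber g
      have hSinf : Set.Infinite (g ⁻¹' {i₀}) := Set.infinite_coe_iff.1 hi₀
      set ζ : ℂ := phase (i₀ : ℕ) * c₀ with hζ
      have hζ0 : ζ ≠ 0 := mul_ne_zero (by rw [hphase]; exact (norm_pos_iff.1 (by rw [norm_urot]; norm_num)))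
        hc₀0
      have hphase_eq : ∀ m, g m = i₀ → phase (m₀ + m) = phase (i₀ : ℕ) := by
        intro m hm
        have h1 : ((i₀ : ℕ)) = (m₀ + m) % Dp := by rw [← hm]
        rw [h1]
        exact (hperiodic.map_mod_nat (m₀ + m)).symm
      -- the subsequence of constant phase
      set φ : ℕ → ℕ := Nat.nth (· ∈ g ⁻¹' {i₀}) with hφ
      have hφS : ∀ j, g (φ j) = i₀ := fun j => Nat.nth_mem_of_infinite (p := (· ∈ g ⁻¹' {i₀})) hSinf j
      have hφtop : Tendsto φ atTop atTop :=
        (Nat.nth_strictMono (p := (· ∈ g ⁻¹' {i₀})) hSinf).tendsto_atTop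
      have hqnorm : Tendsto (fun j => ‖q (φ j) (Sum.inl 0)‖) atTop atTop := by
        refine (hznorm.comp hφtop).congr fun j => ?_
        simp [hq]
      have hw' : AnalyticAt ℂ (fun u => ζ * w u) 0 := analyticAt_const.mul hw
      have hx : ∀ j, q (φ j) (Sum.inl 0) = U (μ (φ j)) * (μ (φ j))⁻¹ ^ k := fun j => by
        simp only [hq, Sum.elim_inl, Matrix.cons_val_zero]
        exact hzμ (φ j)
      have hrel : ∀ j, q (φ j) (Sum.inr 1) = (fun u => ζ * w u) (μ (φ j)) := by
        intro j
        simp only [hq, Sum.elim_inr, Matrix.cons_val_one, Matrix.cons_val_zero]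
        rw [hid' (φ j), hζ]
        have := hphase_eq (φ j) (hφS j)
        simp only [hphase, Nat.cast_add] at this
        push_cast
        rw [this]
        ring
      exact unprojectedDense_of_transcendental_relation_pole hS (le_of_eq hdim) 0 1 (fun j => hqS (φ j))
        (fun j => hqΓ (φ j)) hqnorm hU hw' k (fun j => hμ0 (φ j)) (hμ.comp hφtop) hx hrel
        (transcendental_pole_const_mul hζ0 htr)
    · /- (c) NON-RESONANCE: a relation on all large labels would make the phases accumulate -/
      by_contra hnot
      have hex : ∃ f, f ∈ vanishingIdeal ℂ (S ∩ expGraph ℂ 2) ∧ f ∉ vanishingIdeal ℂ S := by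
        by_contra h
        push Not at h
        exact hnot (le_antisymm h (vanishingIdeal_anti_mono Set.inter_subset_left))
      obtain ⟨f, hfΓ, hfS⟩ := hex
      -- THEOREM H: one relation on all points
      obtain ⟨H, hH0, hH⟩ := exists_polyPoly_relation_of_forall_aeval_eq_zero hS (le_of_eq hdim) hqS hfS
        (fun m => (mem_vanishingIdeal_iff.1 hfΓ) _ ⟨hqS m, hqΓ m⟩) (Sum.inl 0) (Sum.inr 1)
      set e : ℕ → ℂ := fun m => urot (gI.eval ((m₀ + m : ℕ) : ℝ)) with he
      have he1 : ∀ m, ‖e m‖ = 1 := fun m => norm_urot _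
      have hrel : ∀ m, (H.map (Polynomial.evalRingHom (z m))).eval (e m * (c₀ * w (μ m))) = 0 := by
        intro m
        have h1 := hH m
        simp only [hq, Sum.elim_inl, Sum.elim_inr, Matrix.cons_val_zero, Matrix.cons_val_one] at h1
        rwa [hid' m] at h1
      -- the phases accumulate at a finite set …
      have hwlim' : Tendsto (fun m => c₀ * w (μ m)) atTop (𝓝 (c₀ * w 0)) := hwlim.const_mul c₀
      obtain ⟨F, hF⟩ := phases_near_finset_of_relation hH0 hznorm he1 (mul_ne_zero hc₀0 (hw0 0)) hwlim' hrel
      -- … but the non-resonant phase sequence does not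
      obtain ⟨ε, hε, hfar'⟩ := hfar F
      obtain ⟨m₁, hm₁⟩ := Filter.eventually_atTop.1 (hF ε hε)
      obtain ⟨k', hk', hkfar⟩ := hfar' (m₀ + m₁)
      obtain ⟨ζ, hζF, hζ⟩ := hm₁ (k' - m₀) (by omega)
      have hkk : m₀ + (k' - m₀) = k' := by omega
      rw [he] at hζ
      simp only [hkk] at hζ
      exact absurd hζ (not_lt.2 (hkfar ζ hζF))

end Summit.Schanuel.Schanuel.Theorems
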